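/-
Copyright (c) 2026 the pub-hodgecm-mathlib formalisation cell (harness21).  Prover seat hodgecm-mathlib-LH4-p12 (g7), req620 Track A «(D-RAM) FOUR-FRAME», line LH4
(STAGE-1b tier-0 LEVEL rows, (d)-lev PART 5 (dealer WORD #83): THE LABELLED SIGNED κ-STAGE B₀ OF THE LEVEL LAWS AND THE GENERIC LAW HEAD MODULO `LevLabelledBoxSum`,
the G3 cell and the schedule dictionary.  ★ p857128's body VERBATIM over the two-token labelled trunk ★ p860243.)  2026-09-04.
-/
import Summits.HodgeConjecture.HodgeConjecture.Theorems.F0P3cDyRamLevLabelledTrunkOfBoxSumWide              -- (d)-lev PART 4 WIDE (this seat)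
import Summits.HodgeConjecture.HodgeConjecture.Theorems.F0P3cDyRamLevLabelledTrunkOfBoxSum                  -- ★ p860243∕p860279 (this seat): the two-token labelled trunk modulo `LevLabelledBoxSum` (ED. 2: generic `N₀`)
import Summits.HodgeConjecture.HodgeConjecture.Theorems.F0P3cDyRamLevBoxBracketAmpl                        -- ★ p860244 (this seat): bracket ∕ (q−1) = ampl ∕ 4
import Summits.HodgeConjecture.HodgeConjecture.Theorems.F0P3cDyRamLevKappaSignLawAtDepthOfLabelledTrunk     -- ★ p859848 (F0P3a-p01 (g36)): `dyadicFence_levKappaSignLawAtS2_at_of_labelledKappaStageB`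
import Summits.HodgeConjecture.HodgeConjecture.Theorems.F0P3cDyRamSqKappaSignCount2TypeZeroOfLabelledTrunk    -- ★ p859650 (this seat): brings ★ p857128's tools + ★ p859612 (S2a-κ HEAD) + ★ p859556 (S2c)
import Summits.HodgeConjecture.HodgeConjecture.Theorems.F0P3cDyRamSqDatumDerivedFence                       -- ★ p859917 (this seat): the fence from the root guards
import Summits.HodgeConjecture.HodgeConjecture.Theorems.F0P3cDyRamStageOneBDerivedDefs                       -- ★ DEFS №6: `n0DerivedOfRecord`
import Summits.HodgeConjecture.HodgeConjecture.Theorems.F0P3cDyRamStageOneBDefs                              -- ★ p859562 DEFS №5: `amplCs`, `csOfRecord`, `mstarOfRecord`, `SqKappaSignLawAtS2`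
import HarnessLib

/-!
# Crux `H413`, line LH4 «(D-RAM) FOUR-FRAME» — (d)-lev PART 5 WIDE: THE GENERIC LEVEL κ-SIGN LAW ON THE WIDE BOX, NO G3 HYPOTHESIS (the form the OfRecord heads instantiate)

* §1 `kappaSignCount2_typeZero_lev_at_of_boxSum'` ∕ `dyadicFence_levKappaSignLawAtS2_at_of_boxSum'` — the GUARDED forms of ★ p860329's two theorems (every schedule
  hypothesis under `2 ≤ d`; `hlb` may use `N₀ d ≤ nᵢ`, a conjunct of `IsElementDatum`), same proofs.
* §2–§3 (the dictionary of record and the four heads BY NAME) live in the sequel `F0P3cDyRamLevKappaSignLawsOfRecord.lean`.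

HONEST LABEL: helper lane (`--supports stmt-HodgeConjecture-24833`), count-neutral; the heads are CONDITIONAL on the named inputs; pays no tier-0 row until the pen's
pay edition; HC_CM is proved only modulo the 7 printed citations (2 remaining named inputs: hLiu418 = stmt-HodgeConjecture-24832, h413 = stmt-HodgeConjecture-24833)
until rung 0 closes.

## References (NEVER `[KR2]`)
* [Kottwitz1986BaseChangeUnits] R. E. Kottwitz, *Base change for unit elements of Hecke algebras*, Compositio Math. 60 (1986), §1 pp. 240–241.
* [Rogawski1990] J. D. Rogawski, *Automorphic Representations of Unitary Groups in Three Variables*, Ann. of Math. Stud. 123 (1990), §4.9 Prop. 4.9.1 (a) p. 55, §4.10 p. 58.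
* [LanglandsShelstad1987] R. P. Langlands, D. Shelstad, *On the definition of transfer factors*, Math. Ann. 278 (1987), §3.
* [Serre1979] J.-P. Serre, *Local Fields*, GTM 67 (1979), Ch. V §3 Prop. 5, Cor. 3.
-/

set_option autoImplicit false

noncomputable section

namespace Summit.HodgeConjecture.HodgeConjecture.Cruxes.H413.F0P3cDyRamLevKappaSignLawsOfBoxSumWide

open Literature.NumberTheory.Automorphic Literature.NumberTheory.Automorphic.HermitianLattice
open Literature.NumberTheory.Automorphic.UnitaryLatticeTree Literature.NumberTheory.Automorphic.UnitaryThreeFourFrame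
open Literature.NumberTheory.LocalFields Literature.NumberTheory.LocalFields.WildQuadraticDatum
open Summit.HodgeConjecture.HodgeConjecture.Cruxes.H413.F0P3cDyRamFourFrameLawDefsR (shiftR)
open Summit.HodgeConjecture.HodgeConjecture.Cruxes.H413.F0P3cDyRamFourFrameLawDefsR2 (OmegaSchedule)
open Summit.HodgeConjecture.HodgeConjecture.Cruxes.H413.F0P3cDyRamFourFrameCensusDefs (LatticeInLevel)
open Summit.HodgeConjecture.HodgeConjecture.Cruxes.H413.F0P3cDyRamDiagonalTorusDefs (normalisedStableLattices stabiliserWeight IsDualisableLattice)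
open Summit.HodgeConjecture.HodgeConjecture.Cruxes.H413.F0P3cDyRamDiagonalKappaCountDefs (kappaCount)
open Summit.HodgeConjecture.HodgeConjecture.Cruxes.H413.F0P3cDyRamOmegaRDefs (omegaR)
open Summit.HodgeConjecture.HodgeConjecture.Cruxes.H413.F0P3cDyRamKappaAssemblyTools (exists_glue_witness)
open Summit.HodgeConjecture.HodgeConjecture.Cruxes.H413.F0P3cDyRamDiagonalPermutation (isElementDatum_swap isElementDatum_rescale)
open Summit.HodgeConjecture.HodgeConjecture.Cruxes.H413.F0P3cDyRamElementDatumParity (isoceles_of_isElementDatum)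
open Summit.HodgeConjecture.HodgeConjecture.Cruxes.H413.F0P3cDyRamDiagonalGlueSignDefs (IsGlueRep glueSign)
open Summit.HodgeConjecture.HodgeConjecture.Cruxes.H413.F0P3cDyRamDiagonalGlueSignTokenRotations
open Summit.HodgeConjecture.HodgeConjecture.Cruxes.H413.F0P3cDyRamLabelledKappaOrbitCountZero (sqKappaSignModelSum2_of_labelledKappaStageBZero)
open scoped Valued WithZero Matrix MatrixGroups
open Summit.HodgeConjecture.HodgeConjecture.Cruxes.H413.F0P3cDyRamDiagonalGlueSignEval (ampl_eq_zero_of_nonpos)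
open Summit.HodgeConjecture.HodgeConjecture.Cruxes.H413.F0P3cDyRamSqDatumDerivedFence (depths_ge_of_rootGuard)
open Summit.HodgeConjecture.HodgeConjecture.Cruxes.H413.F0P3cDyRamLevLabelledTrunkOfBoxSumWide (labelledTrunk_lev_at_of_boxSumWide)
open Summit.HodgeConjecture.HodgeConjecture.Cruxes.H413.F0P3cDyRamDiagonalStrataDefs
open Summit.HodgeConjecture.HodgeConjecture.Cruxes.H413.F0P3cDyRamDiagonalKappaCoreHangingClass (two_le_d_of_v_two_lt_one)
open Summit.HodgeConjecture.HodgeConjecture.Cruxes.H413.F0P3cDyRamElementDatumParity (depth_mod_two_eq_of_isElementDatum)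
open Summit.HodgeConjecture.HodgeConjecture.Cruxes.H413.F0P3cDyRamLevBoxBracketAmpl (box_bracket_div_eq_ampl_div)
open Summit.HodgeConjecture.HodgeConjecture.Cruxes.H413.F0P3cDyRamLevLabelledBoxSumDefs (LevLabelledBoxSumWide)
open Summit.HodgeConjecture.HodgeConjecture.Cruxes.H413.F0P3cDyRamLevKappaSignLawAtDepthOfLabelledTrunk (dyadicFence_levKappaSignLawAtS2_at_of_labelledKappaStageB)
open Summit.HodgeConjecture.HodgeConjecture.Cruxes.H413.F0P3cDyRamSqKappaSignModelSumOfLabelledStageB (fencedSqKappaSignSlot_of_labelledKappaStageB)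
open Summit.HodgeConjecture.HodgeConjecture.Cruxes.H413.F0P3cDyRamFourFramePieces (mstarOfRecord)
open Summit.HodgeConjecture.HodgeConjecture.Cruxes.H413.F0P3cDyRamStageOneBDefs
open Summit.HodgeConjecture.HodgeConjecture.Cruxes.H413.F0P3cDyRamStageOneBDerivedDefs (n0DerivedOfRecord)
open Summit.HodgeConjecture.HodgeConjecture.Cruxes.H413.F0P3cDyRamLevKappaSignLawAtDepthOfLabelledTrunk (le_n0DerivedOfRecord)
open Summit.HodgeConjecture.HodgeConjecture.Cruxes.H413 (F0P3cDyRamLabelledKappaOrbitCountZero.cast_sum_signChar_mul_ncard_inLevel_eq_eight_mul_finsum_kappaCount_zero)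
open Summit.HodgeConjecture.HodgeConjecture.Cruxes.H413.F0P3cDyRamFourFrameLawDefs (DyadicFence)


/-! ## §1  The guarded generic forms (schedule hypotheses under `2 ≤ d`; `hlb` may use `N₀ d ≤ n`)

The schedules of record satisfy the dictionary only for `d ≥ 1` (e.g. `(sT d − 1) + 2 = sT d + 1` needs `d ≥ 1`), and the clean rows bound `lb d = mcOfRecord d ≤ nᵢ`
through `n0DerivedOfRecord d ≤ nᵢ` (a conjunct of `IsElementDatum`); inside the proof `2 ≤ d` holds (`v 2 < 1` + the datum), so nothing is lost. -/

set_option maxHeartbeats 400000 in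
/-- **(S2b-κS | lev) MODULO THE BOX-SUM, THE G3 CELL AND THE DICTIONARY — GUARDED FORM (ED. 2)**: as `kappaSignCount2_typeZero_lev_at_of_boxSum` with every
schedule hypothesis under `2 ≤ d` and `hlb` fed `N₀ d ≤ n`; the conclusion is the `hBκS0` binder of ★ p859848
`dyadicFence_levKappaSignLawAtS2_at_of_labelledKappaStageB omegaR N₀ la lb kl bl` token for token. [cite: Kottwitz1986BaseChangeUnits, §1 pp. 240–241]
[cite: Rogawski1990, §4.9 Prop. 4.9.1 (a) p. 55; §4.10 p. 58] [cite: LanglandsShelstad1987, §3] [cite: Serre1979, Ch. V §3 Prop. 5, Cor. 3] -/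
theorem kappaSignCount2_typeZero_lev_at_of_boxSumWide (N₀ : ℕ → ℕ) (hN₀ : ∀ d, d ≤ N₀ d) (la lb kl bl : ℕ → ℕ)
    (hla : ∀ d, 2 ≤ d → la d ≤ 2) (hlb : ∀ {d n : ℕ}, 2 ≤ d → 2 * d ≤ n + 1 → N₀ d ≤ n → n % 2 = d % 2 → lb d ≤ n + la d ∧ lb d ≤ n + n % 2)
    (hcorner : ∀ d, 2 ≤ d → d % 2 = 0 → la d = 1 → d + 1 ≤ lb d)
    (hkl : ∀ d, 2 ≤ d → kl d = max (la d) ((lb d + 1) / 2 - d / 2 + (la d + 1 - d % 2) / 2)) (hbl : ∀ d, 2 ≤ d → bl d + 2 * ((la d + 1 - d % 2) / 2) = kl d)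
    (hbox : ∀ d, 2 ≤ d → LevLabelledBoxSumWide (la d) (lb d)) :
    ∀ {K : Type} [Field K] [Valued K ℤᵐ⁰] [CompleteSpace K] [Fintype 𝓀[K]] {σ : K →+* K} {ϖ : K} {d t : ℕ}, IsRamifiedQuadraticDatum σ ϖ d t →
      Valued.v (2 : K) < 1 → ∀ {δ : K}, σ δ = -δ → δ ≠ 0 →
      ∀ {a b : K}, a * σ a = 1 → b * σ b = 1 → Valued.v (a - 1) < Valued.v (2 : K) → Valued.v (b - 1) < Valued.v (2 : K) →
      ∀ {n₁ n₂ n₃ : ℕ}, IsElementDatum σ ϖ (N₀ d) (a * a) (b * b) n₁ n₂ n₃ →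
      ∀ (T : GL (Fin 3) K), (T : Matrix (Fin 3) (Fin 3) K) = Matrix.diagonal ![a * a, b * b, 1] → ∀ (k : ℕ), 2 * k + d = n₁ + n₂ + n₃ + 2 →
      ∀ (i : Fin 3) (B : ℤ), 2 * B = ((![n₁, n₂, n₃] : Fin 3 → ℕ) i : ℤ) - d + 2 - 2 * shiftR d t →
        ∑ᶠ M ∈ {M : Submodule 𝒪[K] (Fin 3 → K) | M ∈ normalisedStableLattices T ∧ IsDualisableLattice σ ϖ M ∧
            (LatticeInLevel ϖ (la d) (Matrix.diagonal ![a * a - 1, b * b - 1, 0]) M ∧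
              LatticeInLevel ϖ (lb d) (Matrix.diagonal ![(a * a - 1) * (a * a - 1), (b * b - 1) * (b * b - 1), 0]) M)},
            (kappaCount σ ϖ 0 i M : ℚ) * stabiliserWeight σ M =
          ((omegaR K σ ϖ d a b i * ((![normSign σ (-1 : K), normSign σ (-1 : K), 1] : Fin 3 → ℤ) i *
            (baseSign σ i * normSign σ (fPartProd δ ![a, b, 1] i))) : ℤ) : ℚ) * ampl (Fintype.card 𝓀[K]) (k - kl d) (B - bl d) / 4 := by
  intro K _ _ _ _ σ ϖ d t hD h2 δ hδ hδ0 a b ha hb ha2 hb2 n₁ n₂ n₃ hE T hT k hk i B hB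
  obtain ⟨-, hvσ, -, -, -, hd1, -⟩ := id hD
  have hN₀ : d ≤ N₀ d := hN₀ d
  obtain ⟨-, -, -, -, -, h₁, h₂, h₃, -, -, -⟩ := id hE
  -- (1) the three glue witnesses (foot 0 ∕ H corner, the swapped foot, the rescaled foot)
  obtain ⟨f₀, hσf₀, hf₀⟩ := exists_glue_witness hD hE hN₀
  obtain ⟨f₁, hσf₁, hf₁⟩ := exists_glue_witness hD (isElementDatum_swap hE) hN₀
  obtain ⟨f₂, hσf₂, hf₂⟩ := exists_glue_witness hD (isElementDatum_rescale hvσ hE) hN₀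
  -- (2) the LABELLED trunk (hypothesis): the labelled sum IS the witness token times the labelled amplitude
  have hfence := depths_ge_of_rootGuard hD ha2 hb2 hE
  obtain ⟨hp1, hp2, hp3⟩ := depth_mod_two_eq_of_isElementDatum hD hE hN₀
  have hd2' : 2 ≤ d := two_le_d_of_v_two_lt_one hD h2
  obtain ⟨hNn1, hNn2, hNn3⟩ := hE.2.2.2.2.2.2.2.2
  have hl1 := hlb hd2' hfence.1 hNn1 hp1
  have hl2 := hlb hd2' hfence.2.1 hNn2 hp2
  have hl3 := hlb hd2' hfence.2.2 hNn3 hp3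
  have hlb' : lb d ≤ n₁ + la d ∧ lb d ≤ n₂ + la d ∧ lb d ≤ n₃ + la d := ⟨hl1.1, hl2.1, hl3.1⟩
  rw [labelledTrunk_lev_at_of_boxSumWide (hbox d hd2') hD h2 hN₀ hE hfence (hla d hd2') hlb' ⟨hl1.2, hl2.2, hl3.2⟩ (hcorner d hd2') T hT k hk i
    hσf₀ hσf₁ hσf₂ hf₀ hf₁ hf₂]
  have hshift0 : shiftR d t = ((d - d % 2 : ℕ) : ℤ) := rfl
  have hB' := hB
  rw [hshift0] at hB'
  have hpi : ((![n₁, n₂, n₃] : Fin 3 → ℕ) i) % 2 = d % 2 := by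
    fin_cases i
    · exact hp1
    · exact hp2
    · exact hp3
  have hni' : (![n₁, n₂, n₃] : Fin 3 → ℕ) i = n₁ ∨ (![n₁, n₂, n₃] : Fin 3 → ℕ) i = n₂ ∨ (![n₁, n₂, n₃] : Fin 3 → ℕ) i = n₃ := by
    fin_cases i <;> simp
  have hlak := hla d hd2'
  have hlbn : lb d ≤ n₁ + la d := hlb'.1
  have hkld := hkl d hd2'
  have hbld := hbl d hd2'
  have hdd : d % 2 ≤ d := Nat.mod_le d 2
  obtain ⟨hfe1, hfe2, hfe3⟩ := hfence
  have hklk : kl d ≤ k := by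
    rw [hkld]; rcases hni' with h | h | h <;> (refine max_le ?_ ?_ <;> omega)
  have hBk : ((![n₁, n₂, n₃] : Fin 3 → ℕ) i + 2 * (d % 2) + 2 - 3 * d) / 2 + 2 * ((la d + 1 - d % 2) / 2) ≤ k := by
    rcases hni' with h | h | h <;> (rw [h]; omega)
  rw [box_bracket_div_eq_ampl_div (Fintype.card 𝓀[K]) Fintype.one_lt_card hkld hbld hB' hpi hklk hBk]
  clear hni' hkld hbld hklk hBk hlak hlbn hdd hd2' hpi hB' hshift0 hp1 hp2 hp3 hlb' hfe1 hfe2 hfe3 hNn1 hNn2 hNn3 hl1 hl2 hl3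
  by_cases hB1 : 1 ≤ B - (bl d : ℤ)
  · -- (4) ALIVE axis: the witness token is the law token
    have hshift : shiftR d t = ((d - d % 2 : ℕ) : ℤ) := rfl
    rw [hshift] at hB
    have hiso := isoceles_of_isElementDatum hD hE
    have htok :
        (if n₁ = n₂ ∧ n₂ = n₃ then ((((![normSign σ (-(1 + f₀)), normSign σ f₀ * normSign σ (-(1 + f₀)), normSign σ f₀] : Fin 3 → ℤ) i : ℤ) : ℚ))
        else if n₂ = n₃ then (![![(normSign σ (-1 : K) : ℚ) * normSign σ (1 + f₀), (normSign σ (-1 : K) : ℚ) * normSign σ f₀ * normSign σ (1 + f₀), (normSign σ f₀ : ℚ)],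
           ![(normSign σ (-1 : K) : ℚ) * normSign σ f₁ * normSign σ (1 + f₁), (normSign σ (-1 : K) : ℚ) * normSign σ (1 + f₁), (normSign σ f₁ : ℚ)],
           ![(normSign σ f₂ : ℚ), (normSign σ (-1 : K) : ℚ) * normSign σ f₂ * normSign σ (1 + f₂), (normSign σ (-1 : K) : ℚ) * normSign σ (1 + f₂)]] : Fin 3 → Fin 3 → ℚ) 0 i
        else if n₁ = n₃ then (![![(normSign σ (-1 : K) : ℚ) * normSign σ (1 + f₀), (normSign σ (-1 : K) : ℚ) * normSign σ f₀ * normSign σ (1 + f₀), (normSign σ f₀ : ℚ)],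
           ![(normSign σ (-1 : K) : ℚ) * normSign σ f₁ * normSign σ (1 + f₁), (normSign σ (-1 : K) : ℚ) * normSign σ (1 + f₁), (normSign σ f₁ : ℚ)],
           ![(normSign σ f₂ : ℚ), (normSign σ (-1 : K) : ℚ) * normSign σ f₂ * normSign σ (1 + f₂), (normSign σ (-1 : K) : ℚ) * normSign σ (1 + f₂)]] : Fin 3 → Fin 3 → ℚ) 1 i
        else (![![(normSign σ (-1 : K) : ℚ) * normSign σ (1 + f₀), (normSign σ (-1 : K) : ℚ) * normSign σ f₀ * normSign σ (1 + f₀), (normSign σ f₀ : ℚ)],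
           ![(normSign σ (-1 : K) : ℚ) * normSign σ f₁ * normSign σ (1 + f₁), (normSign σ (-1 : K) : ℚ) * normSign σ (1 + f₁), (normSign σ f₁ : ℚ)],
           ![(normSign σ f₂ : ℚ), (normSign σ (-1 : K) : ℚ) * normSign σ f₂ * normSign σ (1 + f₂), (normSign σ (-1 : K) : ℚ) * normSign σ (1 + f₂)]] : Fin 3 → Fin 3 → ℚ) 2 i) =
          ((omegaR K σ ϖ d a b i * ((![normSign σ (-1 : K), normSign σ (-1 : K), 1] : Fin 3 → ℤ) i *
            (baseSign σ i * normSign σ (fPartProd δ ![a, b, 1] i))) : ℤ) : ℚ) := by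
      by_cases h123 : n₁ = n₂ ∧ n₂ = n₃
      · -- the H corner: all three depths equal `n₁`
        rw [if_pos h123]
        obtain ⟨h12, h23⟩ := h123
        have h₂' : Valued.v (a * a - 1) = Valued.v ϖ ^ n₁ := by rw [h12]; exact h₂
        have h₃' : Valued.v (a * a - b * b) = Valued.v ϖ ^ n₁ := by rw [h12, h23]; exact h₃
        have hni : (((![n₁, n₂, n₃] : Fin 3 → ℕ) i : ℕ) : ℤ) = n₁ := by fin_cases i <;> simp [h12, h23]
        rw [hni] at hB
        exact hCorner_slot hD hδ hδ0 ha hb h₁ h₂' h₃' hσf₀ (hf₀ h23 (by omega)) (by omega) i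
      · rw [if_neg h123]
        by_cases h23 : n₂ = n₃
        · -- foot 0: `n₂ = n₃ < n₁`
          rw [if_pos h23]
          have h21 : n₂ ≤ n₁ := by omega
          fin_cases i
          · simp only [Fin.zero_eta, Fin.isValue, Matrix.cons_val_zero] at hB ⊢
            exact footZero_slot_zero hD hδ hδ0 ha hb h₁ h₂ h₃ h23 hσf₀ (hf₀ h23 h21) (by omega)
          · simp only [Fin.mk_one, Fin.isValue, Matrix.cons_val_one, Matrix.cons_val_zero] at hB ⊢
            exact footZero_slot_one hD hδ hδ0 ha hb h₁ h₂ h₃ h23 h21 hσf₀ (hf₀ h23 h21) (by omega)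
          · simp only [Fin.reduceFinMk, Fin.isValue, Matrix.cons_val_two, Matrix.cons_val_zero, Matrix.tail_cons, Matrix.head_cons] at hB ⊢
            exact footZero_slot_two hD hδ hδ0 ha hb h₁ h₂ h₃ h21 hσf₀ (hf₀ h23 h21) (by omega)
        · rw [if_neg h23]
          by_cases h13 : n₁ = n₃
          · -- foot 1: `n₁ = n₃ < n₂`, the swapped datum `(b, a)`
            rw [if_pos h13]
            have h12 : n₁ ≤ n₂ := by omega
            fin_cases i
            · simp only [Fin.zero_eta, Fin.isValue, Matrix.cons_val_zero, Matrix.cons_val_one] at hB ⊢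
              exact footOne_slot_zero hD hδ hδ0 ha hb h₁ h₂ h₃ h13 h12 hσf₁ (hf₁ h13 h12) (by omega)
            · simp only [Fin.mk_one, Fin.isValue, Matrix.cons_val_one, Matrix.cons_val_zero] at hB ⊢
              exact footOne_slot_one hD hδ hδ0 ha hb h₁ h₂ h₃ h13 hσf₁ (hf₁ h13 h12) (by omega)
            · simp only [Fin.reduceFinMk, Fin.isValue, Matrix.cons_val_two, Matrix.cons_val_one, Matrix.cons_val_zero, Matrix.tail_cons, Matrix.head_cons] at hB ⊢
              exact footOne_slot_two hD hδ hδ0 ha hb h₁ h₂ h₃ h12 hσf₁ (hf₁ h13 h12) (by omega)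
          · -- foot 2: `n₁ = n₂ < n₃`, the rescaled datum `(a⁻¹, b·a⁻¹)`
            rw [if_neg h13]
            have h12 : n₁ = n₂ := by omega
            have h23' : n₂ ≤ n₃ := by omega
            fin_cases i
            · simp only [Fin.zero_eta, Fin.isValue, Matrix.cons_val_zero, Matrix.cons_val_two, Matrix.tail_cons, Matrix.head_cons] at hB ⊢
              exact footTwo_slot_zero hD hδ hδ0 ha hb h₁ h₂ h₃ h23' hσf₂ (hf₂ h12.symm h23') (by omega)
            · simp only [Fin.mk_one, Fin.isValue, Matrix.cons_val_one, Matrix.cons_val_two, Matrix.cons_val_zero, Matrix.tail_cons, Matrix.head_cons] at hB ⊢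
              exact footTwo_slot_one hD hδ hδ0 ha hb h₁ h₂ h₃ h12 h23' hσf₂ (hf₂ h12.symm h23') (by omega)
            · simp only [Fin.reduceFinMk, Fin.isValue, Matrix.cons_val_two, Matrix.tail_cons, Matrix.head_cons] at hB ⊢
              exact footTwo_slot_two hD hδ hδ0 ha hb h₁ h₂ h₃ h12 hσf₂ (hf₂ h12.symm h23') (by omega)
    rw [htok, mul_div_assoc]
  · -- (3) DEAD axis: the amplitude vanishes on both sides
    have hB0 : B - (bl d : ℤ) ≤ 0 := by omega
    rw [ampl_eq_zero_of_nonpos (Fintype.card_pos_iff.2 ⟨0⟩) _ hB0, zero_div, mul_zero, mul_zero, zero_div]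



/-- **THE LEVEL κ-SIGN LAW AT A GENERIC SCHEDULE — GUARDED FORM (ED. 2)** (the one the OfRecord heads instantiate):
`DyadicFence (LevKappaSignLawAtS2 shiftR omegaR N₀ la lb kl bl σ ϖ d t)` for every place datum — ★ p859848
`dyadicFence_levKappaSignLawAtS2_at_of_labelledKappaStageB omegaR N₀ la lb kl bl` fed with §1.  The four tier-0 ED. 6 stubs `stub_law_levLo ∕ levHi ∕ levCleanLo ∕
levCleanHi` are its instances at the schedules of record (pending F0P3a-p01 (g36)'s dictionary confirmation and (c) `levLabelledBoxSum_holds`, and LH4-p09 (g8)'s G3 cell).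
[cite: Kottwitz1986BaseChangeUnits, §1 pp. 240–241] [cite: Rogawski1990, §4.9 Prop. 4.9.1 (a) p. 55; §4.10 p. 58] [cite: LanglandsShelstad1987, §1.3, §3] -/
theorem dyadicFence_levKappaSignLawAtS2_at_of_boxSumWide (N₀ : ℕ → ℕ) (hN₀ : ∀ d, d ≤ N₀ d) (la lb kl bl : ℕ → ℕ)
    (hla : ∀ d, 2 ≤ d → la d ≤ 2) (hlb : ∀ {d n : ℕ}, 2 ≤ d → 2 * d ≤ n + 1 → N₀ d ≤ n → n % 2 = d % 2 → lb d ≤ n + la d ∧ lb d ≤ n + n % 2)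
    (hcorner : ∀ d, 2 ≤ d → d % 2 = 0 → la d = 1 → d + 1 ≤ lb d)
    (hkl : ∀ d, 2 ≤ d → kl d = max (la d) ((lb d + 1) / 2 - d / 2 + (la d + 1 - d % 2) / 2)) (hbl : ∀ d, 2 ≤ d → bl d + 2 * ((la d + 1 - d % 2) / 2) = kl d)
    (hbox : ∀ d, 2 ≤ d → LevLabelledBoxSumWide (la d) (lb d))
    {K : Type} [Field K] [Valued K ℤᵐ⁰] [CompleteSpace K] [Fintype 𝓀[K]] (σ : K →+* K) (ϖ : K) (d t : ℕ) :
    DyadicFence (K := K) (LevKappaSignLawAtS2 shiftR omegaR N₀ la lb kl bl σ ϖ d t) :=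
  dyadicFence_levKappaSignLawAtS2_at_of_labelledKappaStageB omegaR N₀ la lb kl bl
    (kappaSignCount2_typeZero_lev_at_of_boxSumWide N₀ hN₀ la lb kl bl hla hlb hcorner hkl hbl hbox) σ ϖ d t

end Summit.HodgeConjecture.HodgeConjecture.Cruxes.H413.F0P3cDyRamLevKappaSignLawsOfBoxSumWide

end
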